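import Literature.Analysis.FluidPDE.CylindricalCutoff
import Literature.Analysis.FunctionSpaces.PoincareWeighted
import HarnessLib

/-!
# Lei–Ren–Zhang 2019, (3.6): the weighted Poincaré inequality per period

Analysis/FluidPDE proofs file (theorems only, no definitions, no named facts), on the discharge
path of the named fact `Literature.Analysis.FluidPDE.leiRenZhang2019_liouville_periodic`
(Z. Lei, X. Ren, Q. S. Zhang, arXiv:1902.11229 = Math. Ann. 383 (2022), Theorem 1.1). §3,
(3.6) (arXiv p. 7): "we need the weighted Poincaré inequality in our periodic domain
`D_R (R ≥ 1)`: `∫_{D_R} |Ψ − Ψ̄|² ζ_R² dx ≤ C R² ∫_{D_R} |∇Ψ|² ζ_R² dx`, where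
`Ψ̄ = (∫ζ_R²)⁻¹ ∫Ψζ_R²`", for the `z`-independent radial cut-off `ζ_R = ζ₁(r/R)` of (3.2) and a
`z`-periodic `Ψ` (period `Z₀ = 1`, `D_R = {r < R} × [0, Z₀)`).

The paper proves it from the two-dimensional weighted Poincaré inequality on discs and a
one-dimensional Sobolev embedding in `z`. Here (a shorter road in the tree) it is
**Moser's lemma** (`FunctionSpaces.lintegral_enorm_sub_average_sq_le_of_quasiconcave_weight`:
`∫|G − G_ω|²ω ≤ 2ⁿD²W|Q|(∫ω)⁻¹∫|DG|²ω` for a quasi-concave weight `ω ≤ W` on a convex `Q` of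
diameter `≤ D`) applied on the round stack of `M = ⌈ρ/P⌉` periods `Q = {r ≤ ρ} × [0, MP]`
(diameter `≤ 4ρ` for `P ≤ ρ`, `|Q| ≤ 8∫ω` by the scaling `x ↦ 2x`), with the weight
`ω = ζ² 1_{[0,MP)}(x₂)`; by periodicity every slab functional of the stack is `M` times that of
one period (`IsAxiallyPeriodic.setLIntegral_slabs_eq_mul`) and the weighted mean over the stack
is the mean over one period, so the factor `M` cancels:

* `setIntegral_sub_average_sq_mul_cylCutoff_sq_le` — for `0 < P ≤ ρ`, `ζ = cylCutoff (ρ/2) ρ` and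
  a `P`-periodic `Ψ ∈ C¹`,
  `∫_{zSlab P 0} |Ψ − Ψ̄|² ζ² ≤ 1024 ρ² ∫_{zSlab P 0} ‖∇Ψ‖² ζ²`,
  `Ψ̄ = (∫_{zSlab P 0} Ψζ²)/(∫_{zSlab P 0} ζ²)`, and `0 < ∫_{zSlab P 0} ζ²`.

## References

* Z. Lei, X. Ren, Q. S. Zhang, arXiv:1902.11229, §3 (3.6) and its proof (arXiv p. 7).
  [LeiRenZhang2019]
* G. M. Lieberman, *Second Order Parabolic Differential Equations* (1996), Lemma 6.12 (Moser's
  lemma; tree `FunctionSpaces.PoincareWeighted`). [Lieberman1996]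
-/

noncomputable section

open MeasureTheory Set Function Filter Metric
open _root_.Topology
open scoped InnerProductSpace RealInnerProductSpace NNReal ENNReal Pointwise

namespace Literature.Analysis.FluidPDE

namespace LeiRenZhang2019

/-! ### Plumbing -/

/-- `r(x) ≤ ‖x‖`. [folklore] -/
private theorem cylRadius_le_norm_pwp (x : EuclideanSpace ℝ (Fin 3)) : cylRadius x ≤ ‖x‖ := by
  rw [cylRadius, EuclideanSpace.norm_eq]
  apply Real.sqrt_le_sqrt
  simp only [Fin.sum_univ_three, Real.norm_eq_abs, sq_abs]
  nlinarith [sq_nonneg (x 2)]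

/-- `|x₂| ≤ ‖x‖`. [folklore] -/
private theorem abs_apply_two_le_norm_pwp (x : EuclideanSpace ℝ (Fin 3)) : |x 2| ≤ ‖x‖ := by
  rw [EuclideanSpace.norm_eq, ← Real.sqrt_sq_eq_abs]
  apply Real.sqrt_le_sqrt
  simp only [Fin.sum_univ_three, Real.norm_eq_abs, sq_abs]
  nlinarith [sq_nonneg (x 0), sq_nonneg (x 1)]

/-- `r(y − z) ≤ r(y) + r(z)`. [folklore] -/
private theorem cylRadius_sub_le_pwp (y z : EuclideanSpace ℝ (Fin 3)) :
    cylRadius (y - z) ≤ cylRadius y + cylRadius z := by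
  rw [← norm_horizPart, ← norm_horizPart, ← norm_horizPart, map_sub]
  exact norm_sub_le _ _

/-- `r` is convex along segments: `r(z + τ(y − z)) ≤ max (r y) (r z)` for `τ ∈ [0,1]`. [folklore] -/
private theorem cylRadius_segment_le_pwp (y z : EuclideanSpace ℝ (Fin 3)) {τ : ℝ} (hτ : τ ∈ Icc (0 : ℝ) 1) :
    cylRadius (z + τ • (y - z)) ≤ max (cylRadius y) (cylRadius z) := by
  rw [← norm_horizPart, ← norm_horizPart y, ← norm_horizPart z]
  have e : horizPart (z + τ • (y - z)) = (1 - τ) • horizPart z + τ • horizPart y := by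
    simp only [map_add, map_smul, map_sub, smul_sub, sub_smul, one_smul]; abel
  rw [e]
  calc ‖(1 - τ) • horizPart z + τ • horizPart y‖ ≤ ‖(1 - τ) • horizPart z‖ + ‖τ • horizPart y‖ :=
        norm_add_le _ _
    _ = (1 - τ) * ‖horizPart z‖ + τ * ‖horizPart y‖ := by
        rw [norm_smul, norm_smul, Real.norm_eq_abs, Real.norm_eq_abs,
          abs_of_nonneg (by linarith [hτ.2]), abs_of_nonneg hτ.1]
    _ ≤ (1 - τ) * max ‖horizPart y‖ ‖horizPart z‖ + τ * max ‖horizPart y‖ ‖horizPart z‖ := by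
        gcongr
        · linarith [hτ.2]
        · exact le_max_right _ _
        · exact hτ.1
        · exact le_max_left _ _
    _ = max ‖horizPart y‖ ‖horizPart z‖ := by ring

/-- The cylindrical cut-off is non-increasing in `r`. [folklore] -/
private theorem cylCutoff_anti_pwp {ρ₂ ρ₁ : ℝ} (h : ρ₂ < ρ₁) (h₀ : 0 ≤ ρ₂) {x y : EuclideanSpace ℝ (Fin 3)}
    (hxy : cylRadius x ≤ cylRadius y) : cylCutoff ρ₂ ρ₁ y ≤ cylCutoff ρ₂ ρ₁ x := by
  simp only [cylCutoff, radialCutoff, cutoffProfile, norm_horizPart]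
  refine Real.smoothTransition.monotone (div_le_div_of_nonneg_right ?_ ?_)
  · have := pow_le_pow_left₀ (cylRadius_nonneg x) hxy 2
    linarith
  · have : ρ₂ ^ 2 < ρ₁ ^ 2 := pow_lt_pow_left₀ h h₀ two_ne_zero
    linarith

/-- A `z`-independent function is axially periodic of every period. [folklore] -/
private theorem isAxiallyPeriodic_of_forall_pwp {α : Type*} {f : EuclideanSpace ℝ (Fin 3) → α}
    (hf : ∀ (x : EuclideanSpace ℝ (Fin 3)) (t : ℝ), f (x + t • eZ) = f x) (P : ℝ) :
    IsAxiallyPeriodic P f := fun x => hf x P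

/-- **`m` periods carry `m` times the integral of one period (Bochner form)** for a periodic
integrand integrable on one slab. [folklore] -/
private theorem setIntegral_slabs_eq_mul_pwp {P : ℝ} (hP : 0 < P) {Q : EuclideanSpace ℝ (Fin 3) → ℝ}
    (hQ : IsAxiallyPeriodic P Q) (hQm : AEStronglyMeasurable Q volume)
    (hQi : IntegrableOn Q (zSlab P 0)) (m : ℕ) :
    ∫ x in {x : EuclideanSpace ℝ (Fin 3) | 0 ≤ x 2 ∧ x 2 < m * P}, Q x = m * ∫ x in zSlab P 0, Q x := by
  have hU := iUnion_zSlab_finset_eq hP 0 m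
  simp only [Int.cast_zero, zero_mul, zero_add] at hU
  rw [← hU, integral_biUnion_finset _ (fun k _ => measurableSet_zSlab P k)
    (fun j _ k _ hjk => pairwise_disjoint_zSlab hP hjk) (fun k _ => hQ.integrableOn_zSlab hQm hQi k)]
  have hk : ∀ k : ℤ, ∫ x in zSlab P k, Q x = ∫ x in zSlab P 0, Q x := fun k => by
    rw [setIntegral_zSlab_eq_zero_slab]
    exact setIntegral_congr_fun (measurableSet_zSlab P 0) fun x _ => hQ.periodic_int_mul_smul_eZ k x
  simp_rw [hk]
  rw [Finset.sum_const, Int.card_Ico, nsmul_eq_mul]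
  simp

/-! ### The inequality -/

/-- **The weighted Poincaré inequality per period (Lei–Ren–Zhang 2019, (3.6)).** For
`0 < P ≤ ρ`, the cylindrical cut-off `ζ = cylCutoff (ρ/2) ρ` (`= 1` on `{r ≤ ρ/2}`, `= 0` on
`{r ≥ ρ}`, `z`-independent) and an axially `P`-periodic `Ψ ∈ C¹(ℝ³)`:
`0 < Z := ∫_{zSlab P 0} ζ²` and
`∫_{zSlab P 0} |Ψ − Ψ̄|² ζ² ≤ 1024 ρ² ∫_{zSlab P 0} ‖∇Ψ‖² ζ²`, `Ψ̄ = Z⁻¹ ∫_{zSlab P 0} Ψ ζ²`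
("`∫_{D_R}|Ψ − Ψ̄|²ζ_R² ≤ CR²∫_{D_R}|∇Ψ|²ζ_R²`", `R ≥ 1 = Z₀`). [cite: LeiRenZhang2019, §3 (3.6) (arXiv p. 7), the weighted Poincaré inequality in the periodic domain D_R] -/
theorem setIntegral_sub_average_sq_mul_cylCutoff_sq_le {P ρ : ℝ} (hP : 0 < P) (hPρ : P ≤ ρ)
    {Ψ : EuclideanSpace ℝ (Fin 3) → ℝ} (hΨ : ContDiff ℝ 1 Ψ) (hΨp : IsAxiallyPeriodic P Ψ) :
    0 < ∫ y in zSlab P 0, cylCutoff (ρ / 2) ρ y ^ 2 ∧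
    ∫ x in zSlab P 0, (Ψ x - (∫ y in zSlab P 0, Ψ y * cylCutoff (ρ / 2) ρ y ^ 2) /
        (∫ y in zSlab P 0, cylCutoff (ρ / 2) ρ y ^ 2)) ^ 2 * cylCutoff (ρ / 2) ρ x ^ 2 ≤
      1024 * ρ ^ 2 * ∫ x in zSlab P 0, ‖gradient Ψ x‖ ^ 2 * cylCutoff (ρ / 2) ρ x ^ 2 := by
  have hρ : 0 < ρ := hP.trans_le hPρ
  set φ : EuclideanSpace ℝ (Fin 3) → ℝ := cylCutoff (ρ / 2) ρ with hφdef
  have hρ2 : 0 ≤ ρ / 2 := by positivity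
  have hρρ : ρ / 2 < ρ := half_lt_self hρ
  have hφC : ContDiff ℝ 1 φ := contDiff_cylCutoff _ _
  have hφc : Continuous φ := hφC.continuous
  have hφ0 : ∀ x, 0 ≤ φ x := fun x => cylCutoff_nonneg _ _ _
  have hφ1 : ∀ x, φ x ≤ 1 := fun x => cylCutoff_le_one _ _ _
  have hφsq1 : ∀ x, φ x ^ 2 ≤ 1 := fun x => pow_le_one₀ (hφ0 x) (hφ1 x)
  have hφρ : ∀ x, ρ ≤ cylRadius x → φ x = 0 := fun x hx => cylCutoff_eq_zero hρ2 hρρ hx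
  have hφone : ∀ x, cylRadius x ≤ ρ / 2 → φ x = 1 := fun x hx => cylCutoff_eq_one hρ2 hρρ hx
  have hφz : ∀ (x : EuclideanSpace ℝ (Fin 3)) (t : ℝ), φ (x + t • eZ) = φ x := cylCutoff_add_smul_eZ _ _
  have hφp : IsAxiallyPeriodic P φ := isAxiallyPeriodic_of_forall_pwp hφz P
  have hΨc : Continuous Ψ := hΨ.continuous
  have hx2m : Measurable fun x : EuclideanSpace ℝ (Fin 3) => x 2 :=
    (EuclideanSpace.proj (𝕜 := ℝ) (2 : Fin 3)).continuous.measurable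
  -- ### the number of periods and the stack
  set M : ℕ := ⌈ρ / P⌉₊ with hM
  have hM1 : 1 ≤ M := Nat.one_le_iff_ne_zero.2 (Nat.pos_iff_ne_zero.1 (Nat.ceil_pos.2 (by positivity)))
  have hMr0 : (0 : ℝ) < M := by exact_mod_cast hM1
  have hMP0 : 0 < (M : ℝ) * P := mul_pos hMr0 hP
  have hMP : (M : ℝ) * P ≤ 2 * ρ := by
    have h := (Nat.ceil_lt_add_one (by positivity : 0 ≤ ρ / P)).le
    rw [← hM] at h
    calc (M : ℝ) * P ≤ (ρ / P + 1) * P := mul_le_mul_of_nonneg_right h hP.le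
      _ = ρ + P := by field_simp
      _ ≤ 2 * ρ := by linarith
  set S : Set (EuclideanSpace ℝ (Fin 3)) := {x | 0 ≤ x 2 ∧ x 2 < M * P} with hS
  have hSm : MeasurableSet S := (measurableSet_le measurable_const hx2m).inter (measurableSet_lt hx2m measurable_const)
  set Q : Set (EuclideanSpace ℝ (Fin 3)) := {x | cylRadius x ≤ ρ ∧ x 2 ∈ Icc 0 ((M : ℝ) * P)} with hQ
  have hQm : MeasurableSet Q :=
    (measurableSet_le continuous_cylRadius.measurable measurable_const).inter (measurableSet_Icc.preimage hx2m)
  have hQconv : Convex ℝ Q := by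
    intro y hy z hz a b ha hb hab
    refine ⟨?_, ?_⟩
    · calc cylRadius (a • y + b • z) = ‖horizPart (a • y + b • z)‖ := (norm_horizPart _).symm
        _ = ‖a • horizPart y + b • horizPart z‖ := by rw [map_add, map_smul, map_smul]
        _ ≤ a * ‖horizPart y‖ + b * ‖horizPart z‖ := by
            refine (norm_add_le _ _).trans (le_of_eq ?_)
            rw [norm_smul, norm_smul, Real.norm_eq_abs, Real.norm_eq_abs, abs_of_nonneg ha, abs_of_nonneg hb]
        _ ≤ a * ρ + b * ρ := by
            rw [norm_horizPart, norm_horizPart]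
            exact add_le_add (mul_le_mul_of_nonneg_left hy.1 ha) (mul_le_mul_of_nonneg_left hz.1 hb)
        _ = ρ := by rw [← add_mul, hab, one_mul]
    · have e : (a • y + b • z) 2 = a * y 2 + b * z 2 := by simp
      rw [e]
      exact ⟨by nlinarith [hy.2.1, hz.2.1], by nlinarith [hy.2.2, hz.2.2]⟩
  -- `Q ⊆ B̄(0, 3ρ)`: finite measure
  have hQsub : Q ⊆ closedBall (0 : EuclideanSpace ℝ (Fin 3)) (3 * ρ) := fun x hx => by
    rw [mem_closedBall_zero_iff]
    have h := norm_le_cylRadius_add_abs_apply_two x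
    have h2 : |x 2| ≤ 2 * ρ := by rw [abs_of_nonneg hx.2.1]; exact hx.2.2.trans hMP
    linarith [hx.1]
  have hQt : volume Q ≠ ∞ := (measure_mono hQsub).trans_lt measure_closedBall_lt_top |>.ne
  -- the diameter `≤ 4ρ`
  have hD : ∀ y ∈ Q, ∀ z ∈ Q, ‖y - z‖ ≤ 4 * ρ := by
    intro y hy z hz
    have h := norm_le_cylRadius_add_abs_apply_two (y - z)
    have h1 := cylRadius_sub_le_pwp y z
    have h2 : |(y - z) 2| ≤ (M : ℝ) * P := by
      have e : (y - z) 2 = y 2 - z 2 := by simp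
      rw [e, abs_le]
      constructor <;> linarith [hy.2.1, hy.2.2, hz.2.1, hz.2.2]
    linarith [hy.1, hz.1]
  -- ### the weight `ω = ζ² 1_S`
  set ω : EuclideanSpace ℝ (Fin 3) → ℝ≥0∞ := S.indicator fun x => ENNReal.ofReal (φ x ^ 2) with hωdef
  have hφ2m : Measurable fun x => ENNReal.ofReal (φ x ^ 2) := ENNReal.measurable_ofReal.comp (hφc.pow 2).measurable
  have hωm : Measurable ω := hφ2m.indicator hSm
  have hωQ : ∀ x, x ∉ Q → ω x = 0 := by
    intro x hx
    by_cases hxS : x ∈ S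
    · have hr : ¬cylRadius x ≤ ρ := fun h => hx ⟨h, hxS.1, hxS.2.le⟩
      simp only [hωdef, indicator_of_mem hxS, hφρ x (not_le.1 hr).le]
      simp
    · simp only [hωdef, indicator_of_notMem hxS]
  have hω1 : ∀ x, ω x ≤ 1 := fun x => by
    simp only [hωdef]
    refine (indicator_le_self _ _ x).trans ?_
    rw [← ENNReal.ofReal_one]
    exact ENNReal.ofReal_le_ofReal (hφsq1 x)
  have hωtop : ∀ᵐ x ∂(volume : Measure (EuclideanSpace ℝ (Fin 3))), ω x < ∞ :=
    ae_of_all _ fun x => (hω1 x).trans_lt ENNReal.one_lt_top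
  have hωtoReal : ∀ x, (ω x).toReal = S.indicator (fun x => φ x ^ 2) x := fun x => by
    simp only [hωdef]
    by_cases hx : x ∈ S
    · rw [indicator_of_mem hx, indicator_of_mem hx, ENNReal.toReal_ofReal (sq_nonneg _)]
    · rw [indicator_of_notMem hx, indicator_of_notMem hx, ENNReal.toReal_zero]
  -- quasi-concavity along segments of `Q`
  have hqc : ∀ y ∈ Q, ∀ z ∈ Q, ∀ τ ∈ Icc (0 : ℝ) 1, min (ω y) (ω z) ≤ ω (z + τ • (y - z)) := by
    intro y hy z hz τ hτ
    by_cases hyS : y ∈ S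
    swap
    · simp only [hωdef, indicator_of_notMem hyS]; simp
    by_cases hzS : z ∈ S
    swap
    · simp only [hωdef, indicator_of_notMem hzS]; simp
    have hwS : z + τ • (y - z) ∈ S := by
      have e : (z + τ • (y - z)) 2 = z 2 + τ * (y 2 - z 2) := by simp
      refine ⟨?_, ?_⟩
      · rw [e]; nlinarith [hyS.1, hzS.1, hτ.1, hτ.2]
      · rw [e]
        by_cases hτ1 : τ < 1
        · nlinarith [mul_lt_mul_of_pos_left hzS.2 (sub_pos.2 hτ1), mul_le_mul_of_nonneg_left hyS.2.le hτ.1]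
        · have hτ1' : τ = 1 := le_antisymm hτ.2 (not_lt.1 hτ1)
          rw [hτ1']; linarith [hyS.2]
    simp only [hωdef, indicator_of_mem hyS, indicator_of_mem hzS, indicator_of_mem hwS]
    have hmono : ∀ a b : EuclideanSpace ℝ (Fin 3), φ a ≤ φ b →
        ENNReal.ofReal (φ a ^ 2) ≤ ENNReal.ofReal (φ b ^ 2) := fun a b hab =>
      ENNReal.ofReal_le_ofReal (pow_le_pow_left₀ (hφ0 a) hab 2)
    have hseg := cylRadius_segment_le_pwp y z hτ
    rcases le_total (cylRadius y) (cylRadius z) with h | h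
    · rw [max_eq_right h] at hseg
      exact (min_le_right _ _).trans (hmono _ _ (cylCutoff_anti_pwp hρρ hρ2 hseg))
    · rw [max_eq_left h] at hseg
      exact (min_le_left _ _).trans (hmono _ _ (cylCutoff_anti_pwp hρρ hρ2 hseg))
  -- ### slab functionals: `∫⁻ g ω = M ∫⁻_{zSlab P 0} g ζ²` for periodic `g ≥ 0`
  have hstack : ∀ {g : EuclideanSpace ℝ (Fin 3) → ℝ≥0∞}, Measurable g → IsAxiallyPeriodic P g →
      ∫⁻ x, g x * ω x = M * ∫⁻ x in zSlab P 0, g x * ENNReal.ofReal (φ x ^ 2) := by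
    intro g hgm hgp
    have e : (fun x => g x * ω x) = S.indicator (fun x => g x * ENNReal.ofReal (φ x ^ 2)) := by
      funext x
      simp only [hωdef]
      by_cases hx : x ∈ S
      · rw [indicator_of_mem hx, indicator_of_mem hx]
      · rw [indicator_of_notMem hx, indicator_of_notMem hx, mul_zero]
    have hper : IsAxiallyPeriodic P fun x => g x * ENNReal.ofReal (φ x ^ 2) := fun x => by
      simp only [hgp x, hφp x]
    rw [e, lintegral_indicator hSm]
    have h := hper.setLIntegral_slabs_eq_mul hP 0 M
    simp only [Int.cast_zero, zero_mul, zero_add] at h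
    exact h
  -- the mass `∫⁻ ω = M Z`, `Z = ∫_{zSlab P 0} ζ² > 0`
  set Z : ℝ := ∫ y in zSlab P 0, φ y ^ 2 with hZ
  have hφ2i : IntegrableOn (fun x => φ x ^ 2) (zSlab P 0) volume :=
    integrableOn_zSlab_of_eq_zero_of_le_cylRadius (hφc.pow 2) (ρ := ρ) (fun x hx => by simp [hφρ x hx]) P 0
  have hZ0 : 0 ≤ Z := setIntegral_nonneg (measurableSet_zSlab P 0) fun x _ => sq_nonneg _
  have hlintω : ∫⁻ x, ω x = M * ENNReal.ofReal Z := by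
    have h := hstack (g := fun _ => 1) measurable_const (fun _ => rfl)
    simp only [one_mul] at h
    rw [h, hZ, ofReal_integral_eq_lintegral_ofReal hφ2i (ae_of_all _ fun x => sq_nonneg _)]
  -- `∫⁻ ω ≥ vol({r ≤ ρ/2} × [0, MP/2]) > 0` and `vol Q = 8 vol({r ≤ ρ/2} × [0, MP/2])`
  set Qh : Set (EuclideanSpace ℝ (Fin 3)) := {x | cylRadius x ≤ ρ / 2 ∧ x 2 ∈ Icc 0 ((M : ℝ) * P / 2)} with hQh
  have hQhm : MeasurableSet Qh :=
    (measurableSet_le continuous_cylRadius.measurable measurable_const).inter (measurableSet_Icc.preimage hx2m)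
  have hQh_le : volume Qh ≤ ∫⁻ x, ω x := by
    calc volume Qh = ∫⁻ x in Qh, (1 : ℝ≥0∞) := by rw [setLIntegral_const, one_mul]
      _ ≤ ∫⁻ x in Qh, ω x := by
          refine setLIntegral_mono' hQhm fun x hx => ?_
          have hxS : x ∈ S := ⟨hx.2.1, by linarith [hx.2.2, hMP0]⟩
          simp only [hωdef, indicator_of_mem hxS, hφone x hx.1]
          simp
      _ ≤ ∫⁻ x, ω x := setLIntegral_le_lintegral _ _
  have hQh_pos : 0 < volume Qh := by
    -- `Qh ⊇ ball c δ`, `c = (MP/4) e_z`, `δ = min (ρ/2) (MP/4)`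
    set c : EuclideanSpace ℝ (Fin 3) := ((M : ℝ) * P / 4) • eZ with hc
    have hδ : 0 < min (ρ / 2) ((M : ℝ) * P / 4) := lt_min (by positivity) (by positivity)
    refine (measure_ball_pos volume c hδ).trans_le (measure_mono fun x hx => ?_)
    rw [mem_ball] at hx
    have h1 : cylRadius x ≤ ‖x - c‖ := by
      have e : cylRadius x = cylRadius (x - c) := by
        rw [← norm_horizPart, ← norm_horizPart, hc, sub_eq_add_neg, ← neg_smul, horizPart_add_smul_eZ]
      rw [e]; exact cylRadius_le_norm_pwp _
    have h2 : |x 2 - (M : ℝ) * P / 4| ≤ ‖x - c‖ := by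
      have e : x 2 - (M : ℝ) * P / 4 = (x - c) 2 := by simp [hc, eZ]
      rw [e]; exact abs_apply_two_le_norm_pwp _
    rw [dist_eq_norm] at hx
    have hx' : ‖x - c‖ < min (ρ / 2) ((M : ℝ) * P / 4) := hx
    have hr : ‖x - c‖ < ρ / 2 := hx'.trans_le (min_le_left _ _)
    have hz : ‖x - c‖ < (M : ℝ) * P / 4 := hx'.trans_le (min_le_right _ _)
    rw [abs_le] at h2
    exact ⟨h1.trans hr.le, by linarith, by linarith⟩
  have hω0 : ∫⁻ x, ω x ≠ 0 := (hQh_pos.trans_le hQh_le).ne'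
  have hZpos : 0 < Z := by
    have h : (M : ℝ≥0∞) * ENNReal.ofReal Z ≠ 0 := by rwa [← hlintω]
    have h' : ENNReal.ofReal Z ≠ 0 := fun h0 => h (by rw [h0, mul_zero])
    exact ENNReal.ofReal_pos.1 (pos_iff_ne_zero.2 h')
  have hVQ : volume Q = 8 * volume Qh := by
    have e : Q = (2 : ℝ) • Qh := by
      ext x
      rw [Set.mem_smul_set_iff_inv_smul_mem₀ (two_ne_zero)]
      simp only [hQ, hQh, mem_setOf_eq, cylRadius_smul, PiLp.smul_apply, smul_eq_mul, mem_Icc,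
        abs_inv, abs_two]
      constructor
      · rintro ⟨h1, h2, h3⟩; exact ⟨by linarith, by linarith, by linarith⟩
      · rintro ⟨h1, h2, h3⟩; exact ⟨by linarith, by linarith, by linarith⟩
    rw [e, Measure.addHaar_smul, finrank_euclideanSpace_fin]
    norm_num
  have hVQ_le : volume Q ≤ 8 * ∫⁻ x, ω x := by rw [hVQ]; gcongr
  -- ### integrability of `Ψ` for `ν = ω dx`
  set ν : Measure (EuclideanSpace ℝ (Fin 3)) := volume.withDensity ω with hν
  have hΨφ2c : Continuous fun x => φ x ^ 2 * Ψ x := (hφc.pow 2).mul hΨc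
  have hΨφ2i : IntegrableOn (fun x => φ x ^ 2 * Ψ x) (zSlab P 0) volume :=
    integrableOn_zSlab_of_eq_zero_of_le_cylRadius hΨφ2c (ρ := ρ) (fun x hx => by simp [hφρ x hx]) P 0
  have hΨφ2p : IsAxiallyPeriodic P fun x => φ x ^ 2 * Ψ x := fun x => by simp only [hφp x, hΨp x]
  have hΨφ2S : IntegrableOn (fun x => φ x ^ 2 * Ψ x) S volume := by
    have h := hΨφ2p.integrableOn_slabs hP hΨφ2c.aestronglyMeasurable hΨφ2i 0 M
    simp only [Int.cast_zero, zero_mul, zero_add] at h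
    exact h
  have hΨi : Integrable Ψ ν := by
    rw [hν, integrable_withDensity_iff_integrable_smul' hωm hωtop]
    have e : (fun x => (ω x).toReal • Ψ x) = S.indicator fun x => φ x ^ 2 * Ψ x := by
      funext x
      rw [hωtoReal x, smul_eq_mul]
      by_cases hx : x ∈ S
      · rw [indicator_of_mem hx, indicator_of_mem hx]
      · rw [indicator_of_notMem hx, indicator_of_notMem hx, zero_mul]
    rw [e, integrable_indicator_iff hSm]
    exact hΨφ2S
  -- ### Moser's lemma on the stack
  have hPW := Literature.Analysis.FunctionSpaces.lintegral_enorm_sub_average_sq_le_of_quasiconcave_weight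
    (volume : Measure (EuclideanSpace ℝ (Fin 3))) hΨ hQconv hQm hQt hωm hωQ ENNReal.one_ne_top hω1 hqc hω0
    hΨi hD
  -- the weighted mean over the stack is the mean over one period
  set m : ℝ := (∫ y in zSlab P 0, Ψ y * φ y ^ 2) / Z with hm
  have hνuniv : ν univ = M * ENNReal.ofReal Z := by
    rw [hν, withDensity_apply _ MeasurableSet.univ, Measure.restrict_univ, hlintω]
  have havg : ⨍ z, Ψ z ∂ν = m := by
    rw [average_eq, measureReal_def, hνuniv, ENNReal.toReal_mul, ENNReal.toReal_natCast,
      ENNReal.toReal_ofReal hZ0, hν, integral_withDensity_eq_integral_toReal_smul hωm hωtop, smul_eq_mul]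
    have e : (fun x => (ω x).toReal • Ψ x) = S.indicator fun x => φ x ^ 2 * Ψ x := by
      funext x
      rw [hωtoReal x, smul_eq_mul]
      by_cases hx : x ∈ S
      · rw [indicator_of_mem hx, indicator_of_mem hx]
      · rw [indicator_of_notMem hx, indicator_of_notMem hx, zero_mul]
    rw [e, integral_indicator hSm, setIntegral_slabs_eq_mul_pwp hP hΨφ2p hΨφ2c.aestronglyMeasurable hΨφ2i M, hm]
    have hM0 : (M : ℝ) ≠ 0 := hMr0.ne'
    have e2 : ∫ x in zSlab P 0, φ x ^ 2 * Ψ x = ∫ y in zSlab P 0, Ψ y * φ y ^ 2 :=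
      integral_congr_ae (ae_of_all _ fun x => mul_comm _ _)
    rw [e2]
    field_simp
  -- the two sides as slab integrals
  have hLper : IsAxiallyPeriodic P fun y => (‖Ψ y - m‖ₑ ^ 2 : ℝ≥0∞) := fun x => by simp only [hΨp x]
  have hLm : Measurable fun y => (‖Ψ y - m‖ₑ ^ 2 : ℝ≥0∞) :=
    (hΨc.sub continuous_const).measurable.enorm.pow_const _
  have hint1 : IntegrableOn (fun x => (Ψ x - m) ^ 2 * φ x ^ 2) (zSlab P 0) volume :=
    integrableOn_zSlab_of_eq_zero_of_le_cylRadius (((hΨc.sub continuous_const).pow 2).mul (hφc.pow 2))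
      (ρ := ρ) (fun x hx => by simp [hφρ x hx]) P 0
  have hL : ∫⁻ y, ‖Ψ y - ⨍ z, Ψ z ∂ν‖ₑ ^ 2 ∂ν =
      M * ENNReal.ofReal (∫ x in zSlab P 0, (Ψ x - m) ^ 2 * φ x ^ 2) := by
    rw [havg, hν, lintegral_withDensity_eq_lintegral_mul₀ hωm.aemeasurable hLm.aemeasurable]
    have e : (fun y => (ω * fun y => (‖Ψ y - m‖ₑ ^ 2 : ℝ≥0∞)) y) = fun y => ‖Ψ y - m‖ₑ ^ 2 * ω y := by
      funext y; simp only [Pi.mul_apply, mul_comm]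
    rw [e, hstack hLm hLper, ofReal_integral_eq_lintegral_ofReal hint1 (ae_of_all _ fun x => by positivity)]
    congr 1
    refine setLIntegral_congr_fun (measurableSet_zSlab P 0) fun x _ => ?_
    rw [Real.enorm_eq_ofReal_abs, ← ENNReal.ofReal_pow (abs_nonneg _), sq_abs, ← ENNReal.ofReal_mul (sq_nonneg _)]
  have hgradc : Continuous fun x => ‖gradient Ψ x‖ ^ 2 := (continuous_gradient_of_contDiff hΨ).norm.pow 2
  have hint2 : IntegrableOn (fun x => ‖gradient Ψ x‖ ^ 2 * φ x ^ 2) (zSlab P 0) volume :=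
    integrableOn_zSlab_of_eq_zero_of_le_cylRadius (hgradc.mul (hφc.pow 2)) (ρ := ρ) (fun x hx => by simp [hφρ x hx]) P 0
  have hRper : IsAxiallyPeriodic P fun y => (‖fderiv ℝ Ψ y‖ₑ ^ 2 : ℝ≥0∞) := by
    have hper : (fun y => Ψ (y + P • eZ)) = Ψ := funext fun y => hΨp y
    have key : ∀ x, fderiv ℝ Ψ (x + P • eZ) = fderiv ℝ Ψ x := fun x => by
      have h : fderiv ℝ Ψ (x + P • eZ) = fderiv ℝ (fun y => Ψ (y + P • eZ)) x := by
        rw [fderiv_comp_add_right]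
      rw [h, hper]
    intro x
    show (‖fderiv ℝ Ψ (x + P • eZ)‖ₑ ^ 2 : ℝ≥0∞) = ‖fderiv ℝ Ψ x‖ₑ ^ 2
    rw [key x]
  have hRm : Measurable fun y => (‖fderiv ℝ Ψ y‖ₑ ^ 2 : ℝ≥0∞) :=
    (hΨ.continuous_fderiv one_ne_zero).measurable.enorm.pow_const _
  have hR : ∫⁻ y, ‖fderiv ℝ Ψ y‖ₑ ^ 2 ∂ν = M * ENNReal.ofReal (∫ x in zSlab P 0, ‖gradient Ψ x‖ ^ 2 * φ x ^ 2) := by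
    rw [hν, lintegral_withDensity_eq_lintegral_mul₀ hωm.aemeasurable hRm.aemeasurable]
    have e : (fun y => (ω * fun y => (‖fderiv ℝ Ψ y‖ₑ ^ 2 : ℝ≥0∞)) y) = fun y => ‖fderiv ℝ Ψ y‖ₑ ^ 2 * ω y := by
      funext y; simp only [Pi.mul_apply, mul_comm]
    rw [e, hstack hRm hRper, ofReal_integral_eq_lintegral_ofReal hint2 (ae_of_all _ fun x => by positivity)]
    congr 1
    refine setLIntegral_congr_fun (measurableSet_zSlab P 0) fun x _ => ?_
    rw [← ofReal_norm, ← ENNReal.ofReal_pow (norm_nonneg _), ← ENNReal.ofReal_mul (sq_nonneg _), gradient,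
      LinearIsometryEquiv.norm_map]
  -- ### assemble: cancel the factor `M`
  refine ⟨hZpos, ?_⟩
  have hfin : Module.finrank ℝ (EuclideanSpace ℝ (Fin 3)) = 3 := finrank_euclideanSpace_fin
  rw [hL, hR, hfin, mul_one] at hPW
  set A : ℝ := ∫ x in zSlab P 0, (Ψ x - m) ^ 2 * φ x ^ 2 with hA
  set B : ℝ := ∫ x in zSlab P 0, ‖gradient Ψ x‖ ^ 2 * φ x ^ 2 with hB
  have hB0 : 0 ≤ B := setIntegral_nonneg (measurableSet_zSlab P 0) fun x _ => by positivity
  have hMne : (M : ℝ≥0∞) ≠ 0 := by exact_mod_cast (Nat.pos_iff_ne_zero.1 hM1)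
  have hMtop : (M : ℝ≥0∞) ≠ ∞ := ENNReal.natCast_ne_top M
  have hmass_ne_top : ∫⁻ x, ω x ≠ ∞ := by
    rw [hlintω]; exact ENNReal.mul_ne_top hMtop ENNReal.ofReal_ne_top
  -- `2³ D² |Q| (∫ω)⁻¹ ≤ 2³ (4ρ)² · 8`
  have hcoef : ENNReal.ofReal (2 ^ 3 * (4 * ρ) ^ 2) * volume Q * (∫⁻ x, ω x)⁻¹ ≤
      ENNReal.ofReal (1024 * ρ ^ 2) := by
    calc ENNReal.ofReal (2 ^ 3 * (4 * ρ) ^ 2) * volume Q * (∫⁻ x, ω x)⁻¹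
        ≤ ENNReal.ofReal (2 ^ 3 * (4 * ρ) ^ 2) * (8 * ∫⁻ x, ω x) * (∫⁻ x, ω x)⁻¹ := by gcongr
      _ = ENNReal.ofReal (2 ^ 3 * (4 * ρ) ^ 2) * 8 := by
          rw [mul_assoc, mul_assoc, ENNReal.mul_inv_cancel hω0 hmass_ne_top, mul_one]
      _ = ENNReal.ofReal (1024 * ρ ^ 2) := by
          rw [show (8 : ℝ≥0∞) = ENNReal.ofReal 8 by norm_num, ← ENNReal.ofReal_mul (by positivity)]
          congr 1; ring
  have hkey : (M : ℝ≥0∞) * ENNReal.ofReal A ≤ (M : ℝ≥0∞) * (ENNReal.ofReal (1024 * ρ ^ 2) * ENNReal.ofReal B) := by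
    calc (M : ℝ≥0∞) * ENNReal.ofReal A
        ≤ ENNReal.ofReal (2 ^ 3 * (4 * ρ) ^ 2) * volume Q * (∫⁻ x, ω x)⁻¹ * (M * ENNReal.ofReal B) := hPW
      _ = M * (ENNReal.ofReal (2 ^ 3 * (4 * ρ) ^ 2) * volume Q * (∫⁻ x, ω x)⁻¹ * ENNReal.ofReal B) := by ring
      _ ≤ M * (ENNReal.ofReal (1024 * ρ ^ 2) * ENNReal.ofReal B) := by gcongr
  have h2 : ENNReal.ofReal A ≤ ENNReal.ofReal (1024 * ρ ^ 2) * ENNReal.ofReal B :=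
    (ENNReal.mul_le_mul_iff_right hMne hMtop).1 hkey
  rw [← ENNReal.ofReal_mul (by positivity)] at h2
  exact (ENNReal.ofReal_le_ofReal_iff (by positivity)).1 h2

end LeiRenZhang2019

end Literature.Analysis.FluidPDE

end
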